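import Mathlib
import Literature.Analysis.ValidatedNumerics.BoxCover
import HarnessLib

/-!
# Face conditions of virtual-floor certificates FROM KERNEL INTERVAL ARITHMETIC (kd-tree box certificates)
(helper file for crux stmt-NavierStokesRegularity-27057 `SubOnsagerCeiling.ForwardTailCeilingKP`, `--supports … --as helper`;
LEAD SOC g9, line «kp-shell-barrier», virtual-floor game)

The certificate lemmas of the virtual-floor line (`VirtualFloor.game_top_of_polyCert` p677684, `game_of_polyCert` p671432,
`window4_le_of_coupledCertB` p680792, …) reduce a rung for the Katz–Pavlović chain on a slice of scale ratios `b` to finitely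
many REAL POLYNOMIAL INEQUALITIES, one per active face: the INERTIAL condition
`a₀(V − p x₀x₁) + a₁L(x₀² − p x₁x₂) + a₂L²(x₁² − p x₂x₃) + a₃L³(x₂² − p x₃) < 0` (all `V ∈ [0,1]`, all `(L,p)` of the slice,
all states of the face), the DAMPING SIGN condition, and the analogous conditions of the cubic floors. RUNGS 3–4 replayed such
inequalities with hand-generated tensor-Bernstein `linarith` certificates (one lemma per cell, 36 products each); for the
≈ 50-facet designs the depth-2 game needs (LEAD g8 census v11 §I.8) that is the bottleneck.

This file makes every such condition a KERNEL COMPUTATION with the tree's validated-numerics layer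
(`Literature.Analysis.ValidatedNumerics`: `ArithExpr`, natural interval extension `ArithExpr.enclose` with outward dyadic
rounding, kd-tree box certificates `KdCert`, `KdCert.sound`, checked by `decide +kernel`):

* `VirtualFloor.KernelFace.eval_lt_zero_of_kdCheck` — the S-PROCEDURE FORM: if the kd-tree check certifies
  `e + Σ λ·g ≤ −δ < 0` on a rational box (`g` = the OTHER faces as slacks: linear `d − b·x ≥ 0` and cubic-floor
  `x_{i+1} − κ x_i³ + ε ≥ 0` terms, multipliers `λ ≥ 0`), then `e < 0` at every point of the box where the slacks are
  non-negative — i.e. on the ACTIVE part of the face inside the region, which is all the certificate lemmas ask;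
  `eval_nonneg_of_kdCheck` is the `≥ 0` form for damping-sign conditions;
* expression builders with their real semantics: `inertialExpr` (facet inertial form), `dampExpr` (damping-sign form),
  `floFaceExpr` (cubic-floor face form), over COORDINATE EXPRESSIONS `E₀ … E₃` so that the coordinate fixed by the active
  face can be ELIMINATED exactly (`E_k := (c − Σ_{i≠k} aᵢ xᵢ)/a_k`; the user supplies `Eᵢ.eval x = xᵢ`);
* the variable convention `pt`: slots `0–3` shells `x₀ … x₃` (`x₃` = the virtual floor `y`), `4` feed `V = v²`, `5` rate `L`,
  `6` ratio `p`, `7` damping base `b2 = b²`, `8` spare (damping ratio), and `mem_pt` (box membership from nine interval facts).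
  Treating `L`, `p`, `b2` as independent box variables over a `b`-slice is the sound relaxation RUNGS 3–4 already use.

Measured kernel cost (LEAD g9, farm `lean check`): a 30-node cubic in 5 variables at precision 10 costs ≈ 0.1 s per kd-leaf
(128 leaves 16 s, 1024 leaves 147 s including imports) — a face needs one `decide +kernel`, not 36-product `linarith` cells.
A closing `example` discharges the INERTIAL condition of the cap facet `x₂ ≤ 49/50` of a depth-2 design at the slice
`b ∈ [31/20, 25/16]` (`L ∈ [2397/1000, 2436/1000]`, `p ∈ [77/50, 1553/1000]`) on the part `x₁ ∈ [1/2, 49/50]` using the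
near-cap plane `y ≥ 1.2x₁ + 5.3x₂ − 5.624` of LEAD g8's design as the slack (multiplier `9`), by a 1-leaf kernel check.

HONEST FRAMING: plumbing between two landed layers (validated numerics ↔ virtual-floor certificate lemmas) towards a
MODEL-lattice rung (crux `ForwardTailCeilingKP`, route SubOnsagerCeiling, TL-M2Break); it certifies no design by itself;
nothing here bears on Navier–Stokes regularity; 27057 stays OPEN.
[cite: Moore1966, Theorem 3.1, §4.4 (inclusion property, refinement by subdivision)]
[cite: BarbatoMorandinRomito2011, §2 Lemma 2.1 (the invariant-region inequalities being certified)]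
-/

-- the sub-problem namespace `NavierStokesRegularity.NavierStokesRegularity` is the tree's layout (D-0017)
set_option linter.dupNamespace false

namespace Summit.NavierStokesRegularity.NavierStokesRegularity.Theorems.VirtualFloor.KernelFace

open Literature.Analysis.ValidatedNumerics

/-! ## Slack terms (the other faces of the region, S-procedure) -/

/-- A linear slack term `λ · (d − b₀E₀ − b₁E₁ − b₂E₂ − b₃E₃)` (another facet `b·x ≤ d` of the region, weight `λ ≥ 0`).
[folklore] -/
structure LinSlack where
  /-- multiplier (must be `≥ 0`) -/
  lam : ℚ
  /-- facet normal -/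
  b0 : ℚ
  /-- facet normal -/
  b1 : ℚ
  /-- facet normal -/
  b2 : ℚ
  /-- facet normal -/
  b3 : ℚ
  /-- facet level -/
  d : ℚ
  deriving DecidableEq

/-- A cubic-floor slack term `λ · (E_{i+1} − κ E_i³ + ε)` (the floor `κ x_i³ − ε ≤ x_{i+1}` of the region, weight `λ ≥ 0`;
`i ∈ {0,1,2}`, other values of `i` read as `i = 2`). [folklore] -/
structure FloSlack where
  /-- multiplier (must be `≥ 0`) -/
  lam : ℚ
  /-- lower coordinate of the floor -/
  i : ℕ
  /-- floor constant -/
  κ : ℚ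
  /-- floor offset -/
  ε : ℚ
  deriving DecidableEq

/-- The `i`-th of four coordinate expressions (`i ≥ 3` gives the last). [folklore] -/
def coordE (E0 E1 E2 E3 : ArithExpr) : ℕ → ArithExpr
  | 0 => E0
  | 1 => E1
  | 2 => E2
  | _ => E3

/-- Real semantics of `coordE`. [folklore] -/
theorem eval_coordE (E0 E1 E2 E3 : ArithExpr) (x : ℕ → ℝ) (i : ℕ) :
    (coordE E0 E1 E2 E3 i).eval x =
      if i = 0 then E0.eval x else if i = 1 then E1.eval x else if i = 2 then E2.eval x else E3.eval x := by
  rcases i with _ | _ | _ | i <;> simp [coordE]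

/-- The expression of one linear slack term. [folklore] -/
def LinSlack.expr (s : LinSlack) (E0 E1 E2 E3 : ArithExpr) : ArithExpr :=
  .mul (.const s.lam) (.sub (.sub (.sub (.sub (.const s.d) (.mul (.const s.b0) E0)) (.mul (.const s.b1) E1))
    (.mul (.const s.b2) E2)) (.mul (.const s.b3) E3))

/-- Real semantics of a linear slack term. [folklore] -/
theorem LinSlack.eval_expr (s : LinSlack) (E0 E1 E2 E3 : ArithExpr) (x : ℕ → ℝ) :
    (s.expr E0 E1 E2 E3).eval x =
      (s.lam : ℝ) * ((s.d : ℝ) - s.b0 * E0.eval x - s.b1 * E1.eval x - s.b2 * E2.eval x - s.b3 * E3.eval x) := by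
  simp [LinSlack.expr, ArithExpr.eval]

/-- The expression of one cubic-floor slack term. [folklore] -/
def FloSlack.expr (s : FloSlack) (E0 E1 E2 E3 : ArithExpr) : ArithExpr :=
  .mul (.const s.lam) (.add (.sub (coordE E0 E1 E2 E3 (s.i + 1))
    (.mul (.const s.κ) (.mul (.mul (coordE E0 E1 E2 E3 s.i) (coordE E0 E1 E2 E3 s.i)) (coordE E0 E1 E2 E3 s.i))))
    (.const s.ε))

/-- Real semantics of a cubic-floor slack term. [folklore] -/
theorem FloSlack.eval_expr (s : FloSlack) (E0 E1 E2 E3 : ArithExpr) (x : ℕ → ℝ) :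
    (s.expr E0 E1 E2 E3).eval x =
      (s.lam : ℝ) * ((coordE E0 E1 E2 E3 (s.i + 1)).eval x - s.κ * (coordE E0 E1 E2 E3 s.i).eval x ^ 3 + s.ε) := by
  simp only [FloSlack.expr, ArithExpr.eval_mul, ArithExpr.eval_add, ArithExpr.eval_sub, ArithExpr.eval_const]
  ring

/-- Sum of the linear slack expressions of a list. [folklore] -/
def linSlackExpr (E0 E1 E2 E3 : ArithExpr) : List LinSlack → ArithExpr
  | [] => .const 0
  | s :: l => .add (s.expr E0 E1 E2 E3) (linSlackExpr E0 E1 E2 E3 l)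

/-- Sum of the cubic-floor slack expressions of a list. [folklore] -/
def floSlackExpr (E0 E1 E2 E3 : ArithExpr) : List FloSlack → ArithExpr
  | [] => .const 0
  | s :: l => .add (s.expr E0 E1 E2 E3) (floSlackExpr E0 E1 E2 E3 l)

/-- The linear slack sum is non-negative at a point where every weight and every slack is non-negative. [folklore] -/
theorem eval_linSlackExpr_nonneg (E0 E1 E2 E3 : ArithExpr) (x : ℕ → ℝ) :
    ∀ l : List LinSlack, (∀ s ∈ l, 0 ≤ s.lam) →
      (∀ s ∈ l, 0 ≤ (s.d : ℝ) - s.b0 * E0.eval x - s.b1 * E1.eval x - s.b2 * E2.eval x - s.b3 * E3.eval x) →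
      0 ≤ (linSlackExpr E0 E1 E2 E3 l).eval x
  | [], _, _ => by simp [linSlackExpr]
  | s :: l, hl, hs => by
    have h1 : 0 ≤ (s.expr E0 E1 E2 E3).eval x := by
      rw [LinSlack.eval_expr]
      exact mul_nonneg (by exact_mod_cast hl s (by simp)) (hs s (by simp))
    have h2 := eval_linSlackExpr_nonneg E0 E1 E2 E3 x l (fun s' hs' => hl s' (by simp [hs']))
      (fun s' hs' => hs s' (by simp [hs']))
    simp only [linSlackExpr, ArithExpr.eval]
    linarith

/-- The floor slack sum is non-negative at a point where every weight and every floor slack is non-negative.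
[folklore] -/
theorem eval_floSlackExpr_nonneg (E0 E1 E2 E3 : ArithExpr) (x : ℕ → ℝ) :
    ∀ l : List FloSlack, (∀ s ∈ l, 0 ≤ s.lam) →
      (∀ s ∈ l, 0 ≤ (coordE E0 E1 E2 E3 (s.i + 1)).eval x - s.κ * (coordE E0 E1 E2 E3 s.i).eval x ^ 3 + s.ε) →
      0 ≤ (floSlackExpr E0 E1 E2 E3 l).eval x
  | [], _, _ => by simp [floSlackExpr]
  | s :: l, hl, hs => by
    have h1 : 0 ≤ (s.expr E0 E1 E2 E3).eval x := by
      rw [FloSlack.eval_expr]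
      exact mul_nonneg (by exact_mod_cast hl s (by simp)) (hs s (by simp))
    have h2 := eval_floSlackExpr_nonneg E0 E1 E2 E3 x l (fun s' hs' => hl s' (by simp [hs']))
      (fun s' hs' => hs s' (by simp [hs']))
    simp only [floSlackExpr, ArithExpr.eval]
    linarith

/-! ## The kernel face check and its soundness (S-procedure form) -/

/-- The checked expression: `e + Σ linear slacks + Σ floor slacks`. [folklore] -/
def faceExpr (e : ArithExpr) (E0 E1 E2 E3 : ArithExpr) (ls : List LinSlack) (fs : List FloSlack) : ArithExpr :=
  .add (.add e (linSlackExpr E0 E1 E2 E3 ls)) (floSlackExpr E0 E1 E2 E3 fs)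

/-- **Strict face condition from a kd-tree kernel certificate (S-procedure form).** If the kd-tree check certifies
`e + Σ λ·g ≤ −δ` on the box `B` (natural interval extension on every leaf, Moore 1966 Thm 3.1 / §4.4), `δ > 0`, all
multipliers are `≥ 0`, then at every point of `B` where all slacks `g` are `≥ 0` (the active part of the face inside the
region) the face expression is `< 0`. [cite: Moore1966, Theorem 3.1, §4.4] -/
theorem eval_lt_zero_of_kdCheck {e E0 E1 E2 E3 : ArithExpr} {ls : List LinSlack} {fs : List FloSlack}
    {B : Box} {t : KdCert ℕ} {δ : ℚ} (hδ : 0 < δ)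
    (hcheck : t.check (exprLeOn (faceExpr e E0 E1 E2 E3 ls fs) (-δ)) B = true)
    (hls : ∀ s ∈ ls, 0 ≤ s.lam) (hfs : ∀ s ∈ fs, 0 ≤ s.lam)
    (x : ℕ → ℝ) (hx : B.mem x)
    (hlin : ∀ s ∈ ls, 0 ≤ (s.d : ℝ) - s.b0 * E0.eval x - s.b1 * E1.eval x - s.b2 * E2.eval x - s.b3 * E3.eval x)
    (hflo : ∀ s ∈ fs, 0 ≤ (coordE E0 E1 E2 E3 (s.i + 1)).eval x - s.κ * (coordE E0 E1 E2 E3 s.i).eval x ^ 3 + s.ε) :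
    e.eval x < 0 := by
  have h := eval_le_of_kdCheck hcheck x hx
  have h1 := eval_linSlackExpr_nonneg E0 E1 E2 E3 x ls hls hlin
  have h2 := eval_floSlackExpr_nonneg E0 E1 E2 E3 x fs hfs hflo
  simp only [faceExpr, ArithExpr.eval] at h
  have hδ' : (0 : ℝ) < δ := by exact_mod_cast hδ
  have : ((-δ : ℚ) : ℝ) = -(δ : ℝ) := by push_cast; ring
  rw [this] at h
  linarith

/-- **Non-strict form (`≥ 0`)** for damping-sign conditions: if the kd-tree check certifies `−e + Σ λ·g ≤ 0` on `B`,
then `0 ≤ e` wherever the slacks are non-negative. [cite: Moore1966, Theorem 3.1, §4.4] -/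
theorem eval_nonneg_of_kdCheck {e E0 E1 E2 E3 : ArithExpr} {ls : List LinSlack} {fs : List FloSlack}
    {B : Box} {t : KdCert ℕ}
    (hcheck : t.check (exprLeOn (faceExpr (.neg e) E0 E1 E2 E3 ls fs) 0) B = true)
    (hls : ∀ s ∈ ls, 0 ≤ s.lam) (hfs : ∀ s ∈ fs, 0 ≤ s.lam)
    (x : ℕ → ℝ) (hx : B.mem x)
    (hlin : ∀ s ∈ ls, 0 ≤ (s.d : ℝ) - s.b0 * E0.eval x - s.b1 * E1.eval x - s.b2 * E2.eval x - s.b3 * E3.eval x)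
    (hflo : ∀ s ∈ fs, 0 ≤ (coordE E0 E1 E2 E3 (s.i + 1)).eval x - s.κ * (coordE E0 E1 E2 E3 s.i).eval x ^ 3 + s.ε) :
    0 ≤ e.eval x := by
  have h := eval_le_of_kdCheck hcheck x hx
  have h1 := eval_linSlackExpr_nonneg E0 E1 E2 E3 x ls hls hlin
  have h2 := eval_floSlackExpr_nonneg E0 E1 E2 E3 x fs hfs hflo
  simp only [faceExpr, ArithExpr.eval] at h
  push_cast at h
  linarith

/-! ## Expression builders for the three kinds of face conditions, with their real semantics -/

/-- The INERTIAL form of a linear facet `a·x ≤ c` of the depth-2 game along the field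
`(V − p x₀x₁, L(x₀² − p x₁x₂), L²(x₁² − p x₂x₃), L³(x₂² − p x₃))` (`V` = slot 4, `L` = slot 5, `p` = slot 6).
[cite: BarbatoMorandinRomito2011, §2 Lemma 2.1] -/
def inertialExpr (a0 a1 a2 a3 : ℚ) (E0 E1 E2 E3 : ArithExpr) : ArithExpr :=
  .add (.add (.add
    (.mul (.const a0) (.sub (.var 4) (.mul (.mul (.var 6) E0) E1)))
    (.mul (.const a1) (.mul (.var 5) (.sub (.mul E0 E0) (.mul (.mul (.var 6) E1) E2)))))
    (.mul (.const a2) (.mul (.mul (.var 5) (.var 5)) (.sub (.mul E1 E1) (.mul (.mul (.var 6) E2) E3)))))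
    (.mul (.const a3) (.mul (.mul (.mul (.var 5) (.var 5)) (.var 5)) (.sub (.mul E2 E2) (.mul (.var 6) E3))))

/-- Real semantics of `inertialExpr`. [folklore] -/
theorem eval_inertialExpr (a0 a1 a2 a3 : ℚ) (E0 E1 E2 E3 : ArithExpr) (x : ℕ → ℝ) :
    (inertialExpr a0 a1 a2 a3 E0 E1 E2 E3).eval x =
      (a0 : ℝ) * (x 4 - x 6 * E0.eval x * E1.eval x) + a1 * (x 5 * (E0.eval x ^ 2 - x 6 * E1.eval x * E2.eval x)) +
        a2 * (x 5 ^ 2 * (E1.eval x ^ 2 - x 6 * E2.eval x * E3.eval x)) +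
        a3 * (x 5 ^ 3 * (E2.eval x ^ 2 - x 6 * E3.eval x)) := by
  simp [inertialExpr, ArithExpr.eval]; ring

/-- The DAMPING-SIGN form of a linear facet: `a₀E₀ + a₁·b2·E₁ + a₂·b2²·E₂ + a₃·b2³·E₃` (`b2` = slot 7).
[cite: BarbatoMorandinRomito2011, §2 Lemma 2.1] -/
def dampExpr (a0 a1 a2 a3 : ℚ) (E0 E1 E2 E3 : ArithExpr) : ArithExpr :=
  .add (.add (.add (.mul (.const a0) E0) (.mul (.const a1) (.mul (.var 7) E1)))
    (.mul (.const a2) (.mul (.mul (.var 7) (.var 7)) E2)))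
    (.mul (.const a3) (.mul (.mul (.mul (.var 7) (.var 7)) (.var 7)) E3))

/-- Real semantics of `dampExpr`. [folklore] -/
theorem eval_dampExpr (a0 a1 a2 a3 : ℚ) (E0 E1 E2 E3 : ArithExpr) (x : ℕ → ℝ) :
    (dampExpr a0 a1 a2 a3 E0 E1 E2 E3).eval x =
      (a0 : ℝ) * E0.eval x + a1 * (x 7 * E1.eval x) + a2 * (x 7 ^ 2 * E2.eval x) + a3 * (x 7 ^ 3 * E3.eval x) := by
  simp [dampExpr, ArithExpr.eval]; ring

/-- The INERTIAL form of the cubic floor `κ x_i³ − ε ≤ x_{i+1}` (`i = 0, 1, 2`): `3κ x_i²·Φ_i − Φ_{i+1}`.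
[cite: BarbatoMorandinRomito2011, §2 Lemma 2.1] -/
def floFaceExpr (i : ℕ) (κ : ℚ) (E0 E1 E2 E3 : ArithExpr) : ArithExpr :=
  let Φ0 : ArithExpr := .sub (.var 4) (.mul (.mul (.var 6) E0) E1)
  let Φ1 : ArithExpr := .mul (.var 5) (.sub (.mul E0 E0) (.mul (.mul (.var 6) E1) E2))
  let Φ2 : ArithExpr := .mul (.mul (.var 5) (.var 5)) (.sub (.mul E1 E1) (.mul (.mul (.var 6) E2) E3))
  let Φ3 : ArithExpr := .mul (.mul (.mul (.var 5) (.var 5)) (.var 5)) (.sub (.mul E2 E2) (.mul (.var 6) E3))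
  if i = 0 then .sub (.mul (.mul (.const (3 * κ)) (.mul E0 E0)) Φ0) Φ1
  else if i = 1 then .sub (.mul (.mul (.const (3 * κ)) (.mul E1 E1)) Φ1) Φ2
  else .sub (.mul (.mul (.const (3 * κ)) (.mul E2 E2)) Φ2) Φ3

/-- Real semantics of `floFaceExpr` for `i = 0`. [folklore] -/
theorem eval_floFaceExpr_zero (κ : ℚ) (E0 E1 E2 E3 : ArithExpr) (x : ℕ → ℝ) :
    (floFaceExpr 0 κ E0 E1 E2 E3).eval x =
      3 * (κ : ℝ) * E0.eval x ^ 2 * (x 4 - x 6 * E0.eval x * E1.eval x) -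
        x 5 * (E0.eval x ^ 2 - x 6 * E1.eval x * E2.eval x) := by
  simp [floFaceExpr, ArithExpr.eval]; ring

/-- Real semantics of `floFaceExpr` for `i = 1`. [folklore] -/
theorem eval_floFaceExpr_one (κ : ℚ) (E0 E1 E2 E3 : ArithExpr) (x : ℕ → ℝ) :
    (floFaceExpr 1 κ E0 E1 E2 E3).eval x =
      3 * (κ : ℝ) * E1.eval x ^ 2 * (x 5 * (E0.eval x ^ 2 - x 6 * E1.eval x * E2.eval x)) -
        x 5 ^ 2 * (E1.eval x ^ 2 - x 6 * E2.eval x * E3.eval x) := by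
  simp [floFaceExpr, ArithExpr.eval]; ring

/-- Real semantics of `floFaceExpr` for `i = 2`. [folklore] -/
theorem eval_floFaceExpr_two (κ : ℚ) (E0 E1 E2 E3 : ArithExpr) (x : ℕ → ℝ) :
    (floFaceExpr 2 κ E0 E1 E2 E3).eval x =
      3 * (κ : ℝ) * E2.eval x ^ 2 * (x 5 ^ 2 * (E1.eval x ^ 2 - x 6 * E2.eval x * E3.eval x)) -
        x 5 ^ 3 * (E2.eval x ^ 2 - x 6 * E3.eval x) := by
  simp [floFaceExpr, ArithExpr.eval]; ring

/-- ELIMINATION of the coordinate fixed by an active facet `a·x = c`: the expression `(c − Σ_{i≠k} aᵢ·xᵢ)/a_k` for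
`k = 3` (the other three written for completeness). [folklore] -/
def elimExpr (k : ℕ) (a0 a1 a2 a3 c : ℚ) : ArithExpr :=
  if k = 0 then .mul (.const (1 / a0)) (.sub (.sub (.sub (.const c) (.mul (.const a1) (.var 1)))
    (.mul (.const a2) (.var 2))) (.mul (.const a3) (.var 3)))
  else if k = 1 then .mul (.const (1 / a1)) (.sub (.sub (.sub (.const c) (.mul (.const a0) (.var 0)))
    (.mul (.const a2) (.var 2))) (.mul (.const a3) (.var 3)))
  else if k = 2 then .mul (.const (1 / a2)) (.sub (.sub (.sub (.const c) (.mul (.const a0) (.var 0)))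
    (.mul (.const a1) (.var 1))) (.mul (.const a3) (.var 3)))
  else .mul (.const (1 / a3)) (.sub (.sub (.sub (.const c) (.mul (.const a0) (.var 0)))
    (.mul (.const a1) (.var 1))) (.mul (.const a2) (.var 2)))

/-- On the active facet, the elimination expression for slot `3` evaluates to `x 3`. [folklore] -/
theorem eval_elimExpr_three {a0 a1 a2 a3 c : ℚ} (ha : a3 ≠ 0) (x : ℕ → ℝ)
    (hface : (a0 : ℝ) * x 0 + a1 * x 1 + a2 * x 2 + a3 * x 3 = c) :
    (elimExpr 3 a0 a1 a2 a3 c).eval x = x 3 := by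
  have ha' : (a3 : ℝ) ≠ 0 := by exact_mod_cast ha
  simp [elimExpr, ArithExpr.eval]
  field_simp
  linarith

/-- On the active facet, the elimination expression for slot `2` evaluates to `x 2`. [folklore] -/
theorem eval_elimExpr_two {a0 a1 a2 a3 c : ℚ} (ha : a2 ≠ 0) (x : ℕ → ℝ)
    (hface : (a0 : ℝ) * x 0 + a1 * x 1 + a2 * x 2 + a3 * x 3 = c) :
    (elimExpr 2 a0 a1 a2 a3 c).eval x = x 2 := by
  have ha' : (a2 : ℝ) ≠ 0 := by exact_mod_cast ha
  simp [elimExpr, ArithExpr.eval]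
  field_simp
  linarith

/-! ## The point of a face condition and its box membership -/

/-- The evaluation point: shells `x₀ … x₃` (slot 3 = virtual floor `y`), feed `V`, rate `L`, ratio `p`, damping base
`b2`, spare `r`. [folklore] -/
def pt (x0 x1 x2 x3 V L p b2 r : ℝ) : ℕ → ℝ
  | 0 => x0
  | 1 => x1
  | 2 => x2
  | 3 => x3
  | 4 => V
  | 5 => L
  | 6 => p
  | 7 => b2
  | 8 => r
  | _ => 0

/-- Box membership of the evaluation point from nine interval facts. [folklore] -/
theorem mem_pt {x0 x1 x2 x3 V L p b2 r : ℝ} {l0 h0 l1 h1 l2 h2 l3 h3 l4 h4 l5 h5 l6 h6 l7 h7 l8 h8 : ℚ}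
    (g0 : (l0 : ℝ) ≤ x0 ∧ x0 ≤ h0) (g1 : (l1 : ℝ) ≤ x1 ∧ x1 ≤ h1) (g2 : (l2 : ℝ) ≤ x2 ∧ x2 ≤ h2)
    (g3 : (l3 : ℝ) ≤ x3 ∧ x3 ≤ h3) (g4 : (l4 : ℝ) ≤ V ∧ V ≤ h4) (g5 : (l5 : ℝ) ≤ L ∧ L ≤ h5)
    (g6 : (l6 : ℝ) ≤ p ∧ p ≤ h6) (g7 : (l7 : ℝ) ≤ b2 ∧ b2 ≤ h7) (g8 : (l8 : ℝ) ≤ r ∧ r ≤ h8) :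
    Box.mem [(l0, h0), (l1, h1), (l2, h2), (l3, h3), (l4, h4), (l5, h5), (l6, h6), (l7, h7), (l8, h8)]
      (pt x0 x1 x2 x3 V L p b2 r) := by
  intro i
  rcases i with _ | _ | _ | _ | _ | _ | _ | _ | _ | i
  · simpa [Box.ivl, pt] using g0
  · simpa [Box.ivl, pt] using g1
  · simpa [Box.ivl, pt] using g2
  · simpa [Box.ivl, pt] using g3
  · simpa [Box.ivl, pt] using g4
  · simpa [Box.ivl, pt] using g5
  · simpa [Box.ivl, pt] using g6
  · simpa [Box.ivl, pt] using g7
  · simpa [Box.ivl, pt] using g8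
  · simp [Box.ivl, pt]

/-! ## Worked example: the inertial condition of the cap facet of a depth-2 design, by one kernel check -/

/-- The checked expression of the worked example, written in a DEPENDENCY-FRIENDLY form (each variable grouped):
`L²x₁² + 9(43/100 − (6/5)x₁) + x₃(9 − L²p·49/50)` = (inertial form of the cap facet `x₂ ≤ 49/50` with `x₂ = 49/50`)
+ `9 ×` (slack of the near-cap plane `(6/5)x₁ + (53/10)x₂ − x₃ ≤ 703/125`). The naive form needs 601 kd-leaves at
precision 12, this one 15 (LEAD g9 measurement): write certificates with grouped monomials. [folklore] -/
def exampleCapExpr : ArithExpr :=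
  .add (.add (.mul (.mul (.var 5) (.var 5)) (.mul (.var 1) (.var 1)))
    (.mul (.const 9) (.sub (.const (43 / 100)) (.mul (.const (6 / 5)) (.var 1)))))
    (.mul (.var 3) (.sub (.const 9) (.mul (.mul (.mul (.var 5) (.var 5)) (.var 6)) (.const (49 / 50)))))

/-- EXAMPLE (LEAD g9; mechanics only — no rung is claimed). The cap facet `x₂ ≤ 49/50` of a depth-2 top-shell design at
the slice `b ∈ [31/20, 25/16]` (`L ∈ [2397/1000, 2436/1000] ⊇ b^{399/200}`, `p ∈ [77/50, 1553/1000] ⊇ b^{197/200}`,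
independent box variables — the sound relaxation of RUNGS 3–4): its INERTIAL condition `L²(x₁² − p x₂ x₃) < 0` holds on
the part `x₁ ∈ [3/5, 49/50]`, `x₃ ∈ [0, 1]` of the active facet lying in the half-space of LEAD g8's near-cap plane
`x₃ ≥ (6/5)x₁ + (53/10)x₂ − 703/125` (census v11 §I.5, plane D), via the S-procedure with multiplier `9` and a 15-leaf
kd-tree at precision 12 checked by `decide +kernel`. [cite: Moore1966, Theorem 3.1, §4.4] -/
example : ∀ x0 x1 x2 x3 V L p : ℝ, 0 ≤ x0 → x0 ≤ 1 → 3 / 5 ≤ x1 → x1 ≤ 49 / 50 → 0 ≤ x3 → x3 ≤ 1 →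
    0 ≤ V → V ≤ 1 → 2397 / 1000 ≤ L → L ≤ 2436 / 1000 → 77 / 50 ≤ p → p ≤ 1553 / 1000 →
    x2 = 49 / 50 → (6 : ℝ) / 5 * x1 + 53 / 10 * x2 - x3 ≤ 703 / 125 →
    L ^ 2 * (x1 ^ 2 - p * x2 * x3) < 0 := by
  intro x0 x1 x2 x3 V L p h0 h0' h1 h1' h3 h3' hV hV' hL hL' hp hp' hx2 hD
  have hcheck : (KdCert.split 1 (79 / 100) (.split 1 (139 / 200) (.split 1 (259 / 400) (.split 1 (499 / 800)
      (.split 1 (979 / 1600) (.split 1 (1939 / 3200) (.leaf 12) (.leaf 12)) (.split 1 (1977 / 3200) (.leaf 12) (.leaf 12)))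
      (.split 1 (1017 / 1600) (.leaf 12) (.leaf 12))) (.split 1 (537 / 800) (.leaf 12) (.leaf 12)))
      (.split 1 (297 / 400) (.split 1 (23 / 32) (.leaf 12) (.leaf 12)) (.leaf 12)))
      (.split 1 (177 / 200) (.split 1 (67 / 80) (.leaf 12) (.leaf 12)) (.split 1 (373 / 400) (.leaf 12) (.leaf 12)))).check
      (exprLeOn (faceExpr exampleCapExpr (.var 0) (.var 1) (.var 2) (.var 3) [] []) (-(1 / 10)))
      [(0, 1), (3 / 5, 49 / 50), (0, 1), (0, 1), (0, 1), (2397 / 1000, 2436 / 1000), (77 / 50, 1553 / 1000), (0, 4), (0, 1)]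
      = true := by
    decide +kernel
  have hmem : Box.mem
      [(0, 1), (3 / 5, 49 / 50), (0, 1), (0, 1), (0, 1), (2397 / 1000, 2436 / 1000), (77 / 50, 1553 / 1000), (0, 4), (0, 1)]
      (pt x0 x1 x2 x3 V L p 1 0) :=
    mem_pt ⟨by push_cast; linarith, by push_cast; linarith⟩ ⟨by push_cast; linarith, by push_cast; linarith⟩
      ⟨by rw [hx2]; norm_num, by rw [hx2]; norm_num⟩ ⟨by push_cast; linarith, by push_cast; linarith⟩
      ⟨by push_cast; linarith, by push_cast; linarith⟩ ⟨by push_cast; linarith, by push_cast; linarith⟩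
      ⟨by push_cast; linarith, by push_cast; linarith⟩ ⟨by norm_num, by norm_num⟩ ⟨by norm_num, by norm_num⟩
  have h := eval_lt_zero_of_kdCheck (by norm_num) hcheck (by simp) (by simp) _ hmem (by simp) (by simp)
  simp only [exampleCapExpr, ArithExpr.eval_add, ArithExpr.eval_mul, ArithExpr.eval_sub, ArithExpr.eval_const,
    ArithExpr.eval_var, pt] at h
  push_cast at h
  have key : L ^ 2 * (x1 ^ 2 - p * x2 * x3) =
      (L * L * (x1 * x1) + 9 * (43 / 100 - 6 / 5 * x1) + x3 * (9 - L * L * p * (49 / 50))) -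
        9 * (703 / 125 - 6 / 5 * x1 - 53 / 10 * x2 + x3) := by
    rw [hx2]; ring
  rw [key]
  linarith

end Summit.NavierStokesRegularity.NavierStokesRegularity.Theorems.VirtualFloor.KernelFace
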